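/-
Copyright (c) 2026. All rights reserved.
Released under Apache 2.0 license as described in the file LICENSE.
-/
import Literature.NumberTheory.PAdicHodge.SenRelativeCoordinates
import Literature.NumberTheory.PAdicHodge.SenFiniteVectorsBase
import Literature.NumberTheory.PAdicHodge.TateTraceKernel
import Literature.NumberTheory.PAdicHodge.TateTwistCoboundary
import Literature.NumberTheory.PAdicHodge.TateEigenvectorCoefficients
import Literature.NumberTheory.PAdicHodge.SenDecompletionRankOne
import Literature.NumberTheory.PAdicHodge.TateTraceFixedLinear
import Mathlib.FieldTheory.Galois.Infinite
import HarnessLib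

/-!
# The relative Tate–Sen package over `\widehat{N K_∞} = ℂ_F^{H_N}`

The fifth file of the Sen-decompletion sequence.  For `N ⊆ F̄` finite Galois over `K₀`, with
`H₀ = ker χ`, `H_N = H₀ ∩ Gal(F̄/N)` and `X_N = ℂ_F^{H_N}` (a closed subfield of `ℂ_F` containing
`X = \widehat{K_∞}` and `N`), we transport Tate's normalised traces from `X` to `X_N` along the
coordinates `X_N = ⊕ᵢ bᵢ X` of `SenRelativeCoordinates`:

* **levels** (`exists_level_gen`): there is `n₀` such that for every `n ≥ n₀` some
  `γ = γ^N_n ∈ Gal(F̄/N)` acts on all the `ζ_{p^M}` (hence on `X`) exactly as Tate's generator `γ_n`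
  (`E = N ∩ K_∞ ⊆ K_{n₀}` and the Galois correspondence for `N/K₀`);
* **the package** (`exists_relTatePackage`, ★): for `n ≥ 2` and EVERY `γ ∈ G₀` fixing `N` and acting
  on the `ζ_{p^M}` as `γ_n` (such `γ` exist for `n ≥ n₀(N)` by `exists_level_gen`), the map
  `R = R^N_n := ∑ᵢ bᵢ · R_n ∘ prᵢ : X_N → X_N` is a `γ`-invariant idempotent, additive, with
  (TS2) `‖R x‖ ≤ ‖p‖^{-(k+1)} ‖x‖`, (TS3) `‖x − R x‖ ≤ ‖p‖^{-(k+2)} ‖γ x − x‖`, Tate's surjectivity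
  `R v = 0 ⇒ v = γ c − c` with `R c = 0`, `R = id` on the `γ`-invariants, and the `γ`-invariants of
  `X_N` are exactly (the image of) `N K_n = N ⊔ K_n ⊆ F̄` — i.e. `Λ_{H_N,n} = N_n`,
  `R_{H_N,n} = R_{N,n}` in the notation of Berger–Colmez (TS2)/(TS3) and Prop. 4.1.1.  The constant
  `‖p‖^{-k} ≥ maxᵢ ‖bᵢ‖ ‖b^∨ᵢ‖` only depends on `N`.

This is the input of Sen's decompletion for cocycles that are small only on the open subgroup
`Gal(F̄/N)` (Sen's theorem for representations of `Γ_L`, `L/K₀` finite).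

Main results:
* `TateTrace.exists_level_gen` — levels `n ≥ n₀(N)` carry a generator `γ^N_n ∈ Gal(F̄/N)`.
* `TateTrace.exists_relTatePackage` — ★ the relative Tate–Sen package (TS2)+(TS3) over `ℂ_F^{H_N}`.

References: L. Berger, P. Colmez, *Familles de représentations de de Rham et monodromie p-adique*,
Astérisque 319 (2008), Déf. 3.1.3 (TS2), (TS3) and Prop. 4.1.1 [BergerColmez2008]; J. Tate,
*p-divisible groups* (1967), §3.1–§3.2 [Tate1967]; O. Brinon, B. Conrad, *CMI Summer School notes on
p-adic Hodge theory* (2009), §14.1 and Thm. 15.1.2 [BrinonConrad2009].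
-/

noncomputable section

open ValuativeRel Field UniformSpace Finset Module

namespace Literature.NumberTheory.PAdicHodge

open Literature.NumberTheory.GaloisRepresentations
open Literature.NumberTheory.GaloisRepresentations.IsNonarchimedeanLocalField
open CyclotomicTower

variable {F : Type} [Field F] [ValuativeRel F] [TopologicalSpace F] [IsNonarchimedeanLocalField F]
  [CharZero F] {p : ℕ} [Fact p.Prime] (hp : valuation F p < 1)

namespace TateTrace

variable (N : IntermediateField (PadicBase F p hp) (NormedAlgClosure F))
  [FiniteDimensional (PadicBase F p hp) N] [IsGalois (PadicBase F p hp) N]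

omit [FiniteDimensional (PadicBase F p hp) N] in
/-- `g|_N = 1` iff `g` fixes `N` pointwise. [folklore] -/
private theorem restrictNormalHom_eq_one_iff'' (g : BaseGaloisGroup hp) :
    AlgEquiv.restrictNormalHom N g = 1 ↔ ∀ y : N, g • (y : NormedAlgClosure F) = y := by
  rw [show AlgEquiv.restrictNormalHom N g = g.restrictNormal N from rfl,
    AlgEquiv.restrictNormal_eq_one_iff]
  constructor
  · intro h y; exact h y y.2
  · intro h y hy; exact h ⟨y, hy⟩

omit [FiniteDimensional (PadicBase F p hp) N] [IsGalois (PadicBase F p hp) N] in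
/-- An algebraic element fixed by `H₀ = Gal(F̄/K_∞)` lies in `K_∞` (Galois correspondence for
`F̄/K₀`, closed subgroup `H₀`). [cite: Tate1967, §3.1] -/
private theorem mem_Kinf_of_forall_baseKer_smul_eq {y : NormedAlgClosure F}
    (hy : ∀ g ∈ (BaseGaloisGroup.baseCyclotomicCharacter hp).ker, g • y = y) : y ∈ Kinf hp := by
  haveI : IsGalois (PadicBase F p hp) (NormedAlgClosure F) := inferInstance
  rw [← InfiniteGalois.fixedField_fixingSubgroup (Kinf hp), IntermediateField.mem_fixedField_iff]
  intro g hg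
  exact hy g ((TateSen.mem_baseKer_iff_forall_smul_zeta hp g).mpr
    ((forall_mem_Kinf_smul_eq_iff hp g).mp fun x hx => (mem_fixingSubgroup_iff _).mp hg x hx))

omit [FiniteDimensional (PadicBase F p hp) N] [IsGalois (PadicBase F p hp) N] in
/-- An element of `G₀` fixing `N` pointwise and `ζ_{pⁿ}` fixes `N K_n = N ⊔ K_n` pointwise. [folklore] -/
private theorem smul_eq_self_of_mem_sup {g : BaseGaloisGroup hp}
    (hgN : ∀ y : N, g • (y : NormedAlgClosure F) = y) {n : ℕ} (hgζ : g • zeta F p n = zeta F p n)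
    {w : NormedAlgClosure F} (hw : w ∈ N ⊔ K hp n) : g • w = w := by
  have hstab : ∀ {x : NormedAlgClosure F}, g • x = x →
      x ∈ IntermediateField.fixedField (Subgroup.zpowers g) := by
    intro x hx
    rw [IntermediateField.mem_fixedField_iff]
    intro f hf
    have hle : Subgroup.zpowers g ≤ MulAction.stabilizer (BaseGaloisGroup hp) x :=
      Subgroup.zpowers_le.mpr (MulAction.mem_stabilizer_iff.mpr hx)
    exact MulAction.mem_stabilizer_iff.mp (hle hf)
  have hle : N ⊔ K hp n ≤ IntermediateField.fixedField (Subgroup.zpowers g) := by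
    refine sup_le (fun x hx => hstab (hgN ⟨x, hx⟩)) (fun x hx => hstab ?_)
    have h := smul_eq_smul_of_smul_zeta_eq hp (g := g) (g' := 1) (m := n) (by rw [one_smul]; exact hgζ) hx
    rwa [one_smul] at h
  have h := hle hw
  rw [IntermediateField.mem_fixedField_iff] at h
  exact h g (Subgroup.mem_zpowers g)

/-- **Levels for `N`.**  There is `n₀` such that for every `n ≥ n₀` some `γ ∈ G₀` fixes `N`
pointwise and acts on every `ζ_{p^M}` as Tate's generator `γ_n` (so `γ = γ_n` on `X = \widehat{K_∞}`
and `γ ↦ γ_n` under `Gal(F̄/N)/H_N ↪ G₀/H₀`).  Proof: the fixed field `E = N^{H₀|_N}` consists of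
`H₀`-invariant algebraic elements, so `E ⊆ K_∞` and `E ⊆ K_{n₀}` for some `n₀`; for `n ≥ n₀`,
`γ_n` fixes `E`, hence `γ_n|_N ∈ Gal(N/E) = H₀|_N` (Galois correspondence), i.e. `γ_n|_N = h|_N`
with `h ∈ H₀`, and `γ = h⁻¹ γ_n` works. [cite: BergerColmez2008, §3.1 (n(G), Lemme 3.1.1)]
[cite: Tate1967, §3.1] -/
theorem exists_level_gen :
    ∃ n₀ : ℕ, ∀ n, n₀ ≤ n → ∃ γ : BaseGaloisGroup hp,
      (∀ y : N, γ • (y : NormedAlgClosure F) = y) ∧ ∀ M, γ • zeta F p M = gen hp n • zeta F p M := by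
  classical
  let H0 : Subgroup (BaseGaloisGroup hp) := (BaseGaloisGroup.baseCyclotomicCharacter hp).ker
  let r : BaseGaloisGroup hp →* (N ≃ₐ[PadicBase F p hp] N) := AlgEquiv.restrictNormalHom N
  let S : Subgroup (N ≃ₐ[PadicBase F p hp] N) := H0.map r
  let E : IntermediateField (PadicBase F p hp) N := IntermediateField.fixedField S
  -- every element of `E` is `H₀`-fixed, hence in `K_∞`, hence in some `K_M`
  have hE : ∀ z : E, ∃ M, (((z : N) : NormedAlgClosure F)) ∈ K hp M := by
    intro z
    refine (mem_Kinf_iff hp).mp (mem_Kinf_of_forall_baseKer_smul_eq hp fun g hg => ?_)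
    have hz : ∀ f ∈ S, f (z : N) = z := by
      have h := z.2
      rw [IntermediateField.mem_fixedField_iff] at h
      exact h
    have h1 := hz (r g) (Subgroup.mem_map_of_mem r hg)
    have h2 : (((r g) (z : N) : N) : NormedAlgClosure F) = ((z : N) : NormedAlgClosure F) :=
      congrArg (fun w : N => (w : NormedAlgClosure F)) h1
    change g ((z : N) : NormedAlgClosure F) = _
    rw [← AlgEquiv.restrictNormalHom_apply N g (z : N)]
    exact h2
  choose M hM using hE
  let bE := Module.finBasis (PadicBase F p hp) E
  refine ⟨(∑ j, M (bE j)) + 1, fun n hn => ?_⟩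
  have hn1 : 1 ≤ n := by omega
  -- `γ_n` fixes the basis `bE` of `E`, hence `E`
  have hfixb : ∀ j, gen hp n • (((bE j : E) : N) : NormedAlgClosure F) = ((bE j : E) : N) := by
    intro j
    have hle : M (bE j) ≤ n :=
      le_trans (Finset.single_le_sum (fun i _ => Nat.zero_le (M (bE i))) (Finset.mem_univ j)) (by omega)
    have h := smul_eq_smul_of_smul_zeta_eq hp (g := gen hp n) (g' := 1) (m := n)
      (by rw [one_smul]; exact gen_smul_zeta_self hp hn1) (K_mono hp hle (hM (bE j)))
    rwa [one_smul] at h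
  let φ : E →ₗ[PadicBase F p hp] NormedAlgClosure F :=
    (N.val.toLinearMap).comp (E.val.toLinearMap)
  have hφ : ∀ w : E, φ w = ((w : N) : NormedAlgClosure F) := fun _ => rfl
  have hfixE : ∀ z : E, gen hp n • (((z : N)) : NormedAlgClosure F) = ((z : N) : NormedAlgClosure F) := by
    intro z
    have hz : φ z = ∑ j, bE.repr z j • φ (bE j) := by
      conv_lhs => rw [← bE.sum_repr z]
      rw [map_sum]
      exact Finset.sum_congr rfl fun j _ => map_smul φ _ _
    rw [← hφ, hz, Finset.smul_sum]
    refine Finset.sum_congr rfl fun j _ => ?_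
    rw [smul_comm, hφ, hfixb]
  -- hence `γ_n|_N ∈ Gal(N/E) = S`
  have hmem : r (gen hp n) ∈ S := by
    rw [← IntermediateField.fixingSubgroup_fixedField S]
    refine (mem_fixingSubgroup_iff _).mpr fun x hx => ?_
    apply Subtype.ext
    change (((r (gen hp n)) x : N) : NormedAlgClosure F) = x
    rw [AlgEquiv.restrictNormalHom_apply]
    exact hfixE ⟨x, hx⟩
  obtain ⟨h, hh, hrh⟩ := Subgroup.mem_map.mp hmem
  refine ⟨h⁻¹ * gen hp n, ?_, ?_⟩
  · refine (restrictNormalHom_eq_one_iff'' hp N _).mp ?_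
    change r (h⁻¹ * gen hp n) = 1
    rw [map_mul, map_inv, hrh, inv_mul_cancel]
  · intro M'
    rw [mul_smul]
    have hζ : ∀ M, h⁻¹ • zeta F p M = zeta F p M :=
      (TateSen.mem_baseKer_iff_forall_smul_zeta hp _).mp (H0.inv_mem hh)
    have h1 := smul_eq_smul_of_smul_zeta_eq hp (g := h⁻¹) (g' := 1) (m := M')
      (by rw [one_smul]; exact hζ M') (smul_mem_K hp (gen hp n) (zeta_mem_K hp M'))
    rwa [one_smul] at h1

/-- ★ **The relative Tate–Sen package over `X_N = ℂ_F^{H_N}` (Berger–Colmez (TS2)+(TS3) for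
`Λ̃ = ℂ_F` and the open subgroup `H_N ≤ H₀`).**  Let `N ⊆ F̄` be finite Galois over `K₀` and
`X_N = {x ∈ ℂ_F : g x = x for all g ∈ H₀ fixing N}`.  Then `X_N` is a closed subfield of `ℂ_F`
containing `X = \widehat{K_∞}` and `N`, `g X_N ⊆ X_N` for every `g` fixing `N` pointwise, and there
are `k, n₀` such that for every `n ≥ n₀` and EVERY `γ ∈ G₀` fixing `N` pointwise and acting on the
`ζ_{p^M}` as `γ_n` (such `γ` exist for large `n`, `exists_level_gen`) there is `R : ℂ_F → ℂ_F` with: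
`γ` acts on `X` as `γ_n`, `γ X_N ⊆ X_N`; and on `X_N`:
`R(X_N) ⊆ X_N`, `γ ∘ R = R`, `R ∘ R = R`, `R (x − y) = R x − R y`, `R ∘ γ = R`, `R` is linear over the
`γ`-invariants ((TS2)(2): `R (a x) = a R x` if `γ a = a`),
(TS2) `‖R x‖ ≤ ‖p‖^{-(k+1)} ‖x‖`, (TS3) `‖x − R x‖ ≤ ‖p‖^{-(k+2)} ‖γ x − x‖`,
(Tate) `R v = 0 ⇒ ∃ c ∈ X_N, R c = 0, γ c − c = v`, `R a = a` if `γ a = a`, and the `γ`-invariants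
of `X_N` are exactly the image of `N K_n = N ⊔ K_n ⊆ F̄` (whose elements lie in `X_N`).  Here
`R = ∑ᵢ bᵢ R_n(prᵢ ·)` in the coordinates `X_N = ⊕ᵢ bᵢ X` of `exists_relCoordinates` and
`‖p‖^{-k} ≥ maxᵢ ‖bᵢ‖‖b^∨ᵢ‖`; i.e. `Λ̃^{H_N} = X_N`, `Λ_{H_N,n} = N_n`, `R_{H_N,n} = R_{N,n}`.
[cite: BergerColmez2008, Déf. 3.1.3 (TS2), (TS3) and Prop. 4.1.1] [cite: Tate1967, §3.2]
[cite: BrinonConrad2009, §14.1 and Thm. 15.1.2] -/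
theorem exists_relTatePackage :
    ∃ A : Subfield (CompletedAlgClosure F),
      ((A : Set (CompletedAlgClosure F)) =
        {x | ∀ g ∈ (BaseGaloisGroup.baseCyclotomicCharacter hp).ker,
          (∀ y : N, g • (y : NormedAlgClosure F) = y) → g • x = x}) ∧
      IsClosed (A : Set (CompletedAlgClosure F)) ∧
      X hp ⊆ A ∧
      (∀ y : N, (((y : NormedAlgClosure F)) : CompletedAlgClosure F) ∈ A) ∧
      (∀ g : BaseGaloisGroup hp, (∀ y : N, g • (y : NormedAlgClosure F) = y) → ∀ x ∈ A, g • x ∈ A) ∧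
      ∃ k n₀ : ℕ, ∀ n, n₀ ≤ n → ∀ γ : BaseGaloisGroup hp,
        (∀ y : N, γ • (y : NormedAlgClosure F) = y) →
        (∀ M, γ • zeta F p M = gen hp n • zeta F p M) →
        ∃ (R : CompletedAlgClosure F → CompletedAlgClosure F),
          (∀ c ∈ X hp, γ • c = gen hp n • c) ∧
          (∀ x ∈ A, γ • x ∈ A) ∧
          (∀ x ∈ A, R x ∈ A) ∧
          (∀ x ∈ A, γ • R x = R x) ∧
          (∀ x ∈ A, R (R x) = R x) ∧
          (∀ x ∈ A, ∀ y ∈ A, R (x - y) = R x - R y) ∧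
          (∀ x ∈ A, R (γ • x) = R x) ∧
          (∀ a ∈ A, ∀ x ∈ A, γ • a = a → R (a * x) = a * R x) ∧
          (∀ x ∈ A, ‖R x‖ ≤ ‖(p : PadicBase F p hp)‖⁻¹ ^ (k + 1) * ‖x‖) ∧
          (∀ x ∈ A, ‖x - R x‖ ≤ ‖(p : PadicBase F p hp)‖⁻¹ ^ (k + 2) * ‖γ • x - x‖) ∧
          (∀ v ∈ A, R v = 0 → ∃ c ∈ A, R c = 0 ∧ γ • c - c = v) ∧
          (∀ a ∈ A, γ • a = a → R a = a) ∧
          (∀ a ∈ A, γ • a = a →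
            a ∈ ((↑) : NormedAlgClosure F → CompletedAlgClosure F) ''
              ((N ⊔ K hp n : IntermediateField (PadicBase F p hp) (NormedAlgClosure F)) :
                Set (NormedAlgClosure F))) ∧
          (∀ w ∈ N ⊔ K hp n, ((w : NormedAlgClosure F) : CompletedAlgClosure F) ∈ A ∧
            γ • ((w : NormedAlgClosure F) : CompletedAlgClosure F) = (w : CompletedAlgClosure F)) := by
  classical
  let H0 : Subgroup (BaseGaloisGroup hp) := (BaseGaloisGroup.baseCyclotomicCharacter hp).ker
  have hN : H0.Normal := MonoidHom.normal_ker _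
  let r : BaseGaloisGroup hp →* (N ≃ₐ[PadicBase F p hp] N) := AlgEquiv.restrictNormalHom N
  have r_eq_one_iff : ∀ g : BaseGaloisGroup hp,
      r g = 1 ↔ ∀ y : N, g • (y : NormedAlgClosure F) = y :=
    fun g => restrictNormalHom_eq_one_iff'' hp N g
  -- the predicate `H_N`-fixed and the subfield `X_N`
  let Fix : CompletedAlgClosure F → Prop := fun x =>
    ∀ g ∈ H0, (∀ y : N, g • (y : NormedAlgClosure F) = y) → g • x = x
  let A : Subfield (CompletedAlgClosure F) :=
    { carrier := {x | Fix x}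
      mul_mem' := fun {a b} ha hb g hg hgN => by rw [smul_mul', ha g hg hgN, hb g hg hgN]
      one_mem' := fun g _ _ => smul_one g
      add_mem' := fun {a b} ha hb g hg hgN => by rw [smul_add, ha g hg hgN, hb g hg hgN]
      zero_mem' := fun g _ _ => smul_zero g
      neg_mem' := fun {a} ha g hg hgN => by rw [smul_neg, ha g hg hgN]
      inv_mem' := fun a ha g hg hgN => by rw [smul_inv'', ha g hg hgN] }
  have memA : ∀ {x}, x ∈ A ↔ Fix x := fun {_} => Iff.rfl
  -- basic facts about `Fix`
  have smul_coe_of_fixN : ∀ {g : BaseGaloisGroup hp}, (∀ y : N, g • (y : NormedAlgClosure F) = y) →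
      ∀ y : N, g • (((y : NormedAlgClosure F)) : CompletedAlgClosure F) =
        ((y : NormedAlgClosure F) : CompletedAlgClosure F) := by
    intro g hg y
    rw [CompletedAlgClosure.base_smul_coe, hg y]
  have fixX : ∀ {c}, c ∈ X hp → Fix c := by
    intro c hc g hg _
    rw [← fixedPoints_eq_X hp] at hc
    exact hc g ((TateSen.mem_baseKer_iff_forall_smul_zeta hp g).mp hg)
  have fixCoe : ∀ y : N, Fix (((y : NormedAlgClosure F)) : CompletedAlgClosure F) :=
    fun y g _ hgN => smul_coe_of_fixN hgN y
  have fix_smul : ∀ {g : BaseGaloisGroup hp}, (∀ y : N, g • (y : NormedAlgClosure F) = y) →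
      ∀ {x}, Fix x → Fix (g • x) := by
    intro g hgN x hx k hk hkN
    have hconj : g⁻¹ * k * g⁻¹⁻¹ ∈ H0 := hN.conj_mem k hk g⁻¹
    rw [inv_inv] at hconj
    have hfixN : ∀ y : N, (g⁻¹ * k * g) • (y : NormedAlgClosure F) = y := by
      refine (r_eq_one_iff _).mp ?_
      rw [map_mul, map_mul, (r_eq_one_iff k).mpr hkN, mul_one, ← map_mul, inv_mul_cancel, map_one]
    have h1 := hx _ hconj hfixN
    calc k • g • x = g • ((g⁻¹ * k * g) • x) := by
          rw [← mul_smul, ← mul_smul, ← mul_assoc, ← mul_assoc, mul_inv_cancel, one_mul]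
      _ = g • x := by rw [h1]
  have hclosed : IsClosed (A : Set (CompletedAlgClosure F)) := by
    have hset : (A : Set (CompletedAlgClosure F)) =
        ⋂ (g : BaseGaloisGroup hp) (_ : g ∈ H0) (_ : ∀ y : N, g • (y : NormedAlgClosure F) = y),
          {x | g • x = x} := by
      ext x
      simp only [Set.mem_iInter, Set.mem_setOf_eq]
      exact memA
    rw [hset]
    exact isClosed_iInter fun g => isClosed_iInter fun _ => isClosed_iInter fun _ =>
      isClosed_eq (CompletedAlgClosure.continuous_base_smul hp g) continuous_id
  -- the coordinates and the levels
  obtain ⟨e, b, bd, pr, he, hcont, hlin, hbdd, hval, hrec, hcoord, huniq, hequiv, hspan⟩ :=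
    exists_relCoordinates hp N
  -- the constant `‖p‖^{-k} ≥ maxᵢ ‖bᵢ‖ ‖b^∨ᵢ‖`
  have hπ0 : 0 < ‖(p : PadicBase F p hp)‖ :=
    norm_pos_iff.mpr (by exact_mod_cast (Fact.out : p.Prime).ne_zero)
  have hπ1 : ‖(p : PadicBase F p hp)‖ < 1 := PadicBase.norm_p_lt_one hp
  have hπi1 : 1 < ‖(p : PadicBase F p hp)‖⁻¹ := one_lt_inv_iff₀.mpr ⟨hπ0, hπ1⟩
  have hπi0 : 0 ≤ ‖(p : PadicBase F p hp)‖⁻¹ := inv_nonneg.mpr (norm_nonneg _)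
  obtain ⟨k, hk⟩ := pow_unbounded_of_one_lt
    (∑ i, ‖(((b i : N) : NormedAlgClosure F) : CompletedAlgClosure F)‖ *
      ‖(((bd i : N) : NormedAlgClosure F) : CompletedAlgClosure F)‖) hπi1
  have hbk : ∀ i, ‖(((b i : N) : NormedAlgClosure F) : CompletedAlgClosure F)‖ *
      ‖(((bd i : N) : NormedAlgClosure F) : CompletedAlgClosure F)‖ ≤
        ‖(p : PadicBase F p hp)‖⁻¹ ^ k := fun i =>
    (Finset.single_le_sum
      (f := fun j => ‖(((b j : N) : NormedAlgClosure F) : CompletedAlgClosure F)‖ *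
        ‖(((bd j : N) : NormedAlgClosure F) : CompletedAlgClosure F)‖)
      (fun j _ => mul_nonneg (norm_nonneg _) (norm_nonneg _)) (Finset.mem_univ i)).trans hk.le
  refine ⟨A, rfl, hclosed, fun c hc => fixX hc, fixCoe, fun g hg x hx => fix_smul hg hx, k, 2,
    fun n hn γ hγN hγζ => ?_⟩
  have hn2 : 2 ≤ n := hn
  have hn1 : 1 ≤ n := by omega
  have hγX : ∀ c ∈ X hp, γ • c = gen hp n • c := fun c hc =>
    base_smul_eq_of_forall_smul_zeta_eq hp hγζ hc
  have hγ_coe : ∀ y : N, γ • (((y : NormedAlgClosure F)) : CompletedAlgClosure F) =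
      ((y : NormedAlgClosure F) : CompletedAlgClosure F) := smul_coe_of_fixN hγN
  -- Tate's trace, extended by zero off `X`
  let Rt : CompletedAlgClosure F → CompletedAlgClosure F := fun z =>
    if hz : z ∈ X hp then Rhat hp n ⟨z, hz⟩ else 0
  have Rt_eq : ∀ z (hz : z ∈ X hp), Rt z = Rhat hp n ⟨z, hz⟩ := fun z hz => dif_pos hz
  have Rt_mem : ∀ z, z ∈ X hp → Rt z ∈ X hp := fun z hz => by
    rw [Rt_eq z hz]; exact Rhat_mem_X hp hn2 _
  have Rt_gen : ∀ z, z ∈ X hp → gen hp n • Rt z = Rt z := fun z hz => by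
    rw [Rt_eq z hz]; exact gen_smul_Rhat hp hn2 _
  have Rt_Rt : ∀ z, z ∈ X hp → Rt (Rt z) = Rt z := fun z hz => by
    rw [Rt_eq _ (Rt_mem z hz)]
    have h := Rhat_Rhat hp hn2 ⟨z, hz⟩
    simp only [← Rt_eq z hz] at h ⊢
    convert h using 2
  have Rt_sub : ∀ z z', z ∈ X hp → z' ∈ X hp → Rt (z - z') = Rt z - Rt z' := fun z z' hz hz' => by
    rw [Rt_eq _ (sub_mem_X hp hz hz'), Rt_eq z hz, Rt_eq z' hz']
    exact Rhat_sub hp hn2 ⟨z, hz⟩ ⟨z', hz'⟩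
  have Rt_norm : ∀ z, z ∈ X hp → ‖Rt z‖ ≤ ‖(p : PadicBase F p hp)‖⁻¹ * ‖z‖ := fun z hz => by
    rw [Rt_eq z hz]; exact norm_Rhat_le hp hn2 _
  have Rt_TS3 : ∀ z, z ∈ X hp →
      ‖z - Rt z‖ ≤ ‖(p : PadicBase F p hp)‖⁻¹ ^ 2 * ‖gen hp n • z - z‖ := fun z hz => by
    rw [Rt_eq z hz]; exact norm_sub_Rhat_le hp hn2 ⟨z, hz⟩
  -- the relative trace `R = ∑ bᵢ R_n prᵢ`
  let R : CompletedAlgClosure F → CompletedAlgClosure F := fun x =>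
    ∑ i, (((b i : N) : NormedAlgClosure F) : CompletedAlgClosure F) * Rt (pr i x)
  have R_apply : ∀ x, R x =
      ∑ i, (((b i : N) : NormedAlgClosure F) : CompletedAlgClosure F) * Rt (pr i x) := fun _ => rfl
  have hprX : ∀ {x}, Fix x → ∀ i, pr i x ∈ X hp := fun hx i => hval i _ hx
  -- `prᵢ (R x) = R_n (prᵢ x)`
  have pr_R : ∀ {x}, Fix x → ∀ i, pr i (R x) = Rt (pr i x) := by
    intro x hx i
    rw [R_apply]
    exact huniq _ (fun j => Rt_mem _ (hprX hx j)) i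
  -- (R1) values in `X_N`
  have hR1 : ∀ x, Fix x → Fix (R x) := fun x hx => hspan _ fun j => Rt_mem _ (hprX hx j)
  -- (R2) `γ`-invariance
  have hR2 : ∀ x, Fix x → γ • R x = R x := by
    intro x hx
    rw [R_apply, Finset.smul_sum]
    refine Finset.sum_congr rfl fun i _ => ?_
    rw [smul_mul', hγ_coe, hγX _ (Rt_mem _ (hprX hx i)), Rt_gen _ (hprX hx i)]
  -- (R3) idempotence
  have hR3 : ∀ x, Fix x → R (R x) = R x := by
    intro x hx
    calc R (R x) = ∑ i, (((b i : N) : NormedAlgClosure F) : CompletedAlgClosure F) * Rt (pr i (R x)) :=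
          R_apply _
      _ = ∑ i, (((b i : N) : NormedAlgClosure F) : CompletedAlgClosure F) * Rt (pr i x) :=
          Finset.sum_congr rfl fun i _ => by rw [pr_R hx i, Rt_Rt _ (hprX hx i)]
      _ = R x := (R_apply x).symm
  -- (R4) additivity
  have hR4 : ∀ x y, Fix x → Fix y → R (x - y) = R x - R y := by
    intro x y hx hy
    rw [R_apply, R_apply, R_apply, ← Finset.sum_sub_distrib]
    refine Finset.sum_congr rfl fun i _ => ?_
    rw [← mul_sub, map_sub, Rt_sub _ _ (hprX hx i) (hprX hy i)]
  -- (R4b) `R ∘ γ = R`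
  have hR4b : ∀ x, Fix x → R (γ • x) = R x := by
    intro x hx
    rw [R_apply, R_apply]
    refine Finset.sum_congr rfl fun i _ => ?_
    have hγprX : γ • pr i x ∈ X hp := smul_mem_X hp γ (hprX hx i)
    rw [← hequiv i γ hγN x hx, Rt_eq _ hγprX, Rt_eq _ (hprX hx i)]
    have h1 : (⟨γ • pr i x, hγprX⟩ : X hp) =
        ⟨gen hp n • (((⟨pr i x, hprX hx i⟩ : X hp)) : CompletedAlgClosure F),
          smul_mem_X hp (gen hp n) (hprX hx i)⟩ := Subtype.ext (hγX _ (hprX hx i))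
    rw [h1, Rhat_base_smul hp hn2, gen_smul_Rhat hp hn2]
  -- (R4c) linearity over the `γ`-invariants (structure constants `pr_l (b_i b_j) ∈ X^γ`)
  have hR4c : ∀ a x, Fix a → Fix x → γ • a = a → R (a * x) = a * R x := by
    intro a x ha hx hγa
    have hbbA : ∀ i j, Fix ((((b i : N) : NormedAlgClosure F) : CompletedAlgClosure F) *
        (((b j : N) : NormedAlgClosure F) : CompletedAlgClosure F)) := fun i j =>
      (mul_mem (fixCoe (b i)) (fixCoe (b j)) : _ ∈ A)
    have hcX : ∀ i j l, pr l ((((b i : N) : NormedAlgClosure F) : CompletedAlgClosure F) *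
        (((b j : N) : NormedAlgClosure F) : CompletedAlgClosure F)) ∈ X hp := fun i j l =>
      hprX (hbbA i j) l
    have hγc : ∀ i j l, gen hp n • pr l ((((b i : N) : NormedAlgClosure F) : CompletedAlgClosure F) *
        (((b j : N) : NormedAlgClosure F) : CompletedAlgClosure F)) =
        pr l ((((b i : N) : NormedAlgClosure F) : CompletedAlgClosure F) *
          (((b j : N) : NormedAlgClosure F) : CompletedAlgClosure F)) := by
      intro i j l
      rw [← hγX _ (hcX i j l), hequiv l γ hγN _ (hbbA i j), smul_mul', hγ_coe, hγ_coe]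
    have hγpra : ∀ i, gen hp n • pr i a = pr i a := fun i => by
      rw [← hγX _ (hprX ha i), hequiv i γ hγN a ha, hγa]
    -- the product of two coordinate expansions
    have key : ∀ u y : Fin e → CompletedAlgClosure F,
        (∑ i, (((b i : N) : NormedAlgClosure F) : CompletedAlgClosure F) * u i) *
          (∑ j, (((b j : N) : NormedAlgClosure F) : CompletedAlgClosure F) * y j) =
        ∑ l, (((b l : N) : NormedAlgClosure F) : CompletedAlgClosure F) *
          ∑ q : Fin e × Fin e, pr l ((((b q.1 : N) : NormedAlgClosure F) : CompletedAlgClosure F) *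
            (((b q.2 : N) : NormedAlgClosure F) : CompletedAlgClosure F)) * (u q.1 * y q.2) := by
      intro u y
      calc (∑ i, (((b i : N) : NormedAlgClosure F) : CompletedAlgClosure F) * u i) *
            (∑ j, (((b j : N) : NormedAlgClosure F) : CompletedAlgClosure F) * y j)
          = ∑ i, ∑ j, ((((b i : N) : NormedAlgClosure F) : CompletedAlgClosure F) *
              (((b j : N) : NormedAlgClosure F) : CompletedAlgClosure F)) * (u i * y j) := by
            rw [Finset.sum_mul_sum]
            exact Finset.sum_congr rfl fun i _ => Finset.sum_congr rfl fun j _ => by ring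
        _ = ∑ i, ∑ j, ∑ l, (((b l : N) : NormedAlgClosure F) : CompletedAlgClosure F) *
              (pr l ((((b i : N) : NormedAlgClosure F) : CompletedAlgClosure F) *
                (((b j : N) : NormedAlgClosure F) : CompletedAlgClosure F)) * (u i * y j)) := by
            refine Finset.sum_congr rfl fun i _ => Finset.sum_congr rfl fun j _ => ?_
            conv_lhs => rw [hrec _ (hbbA i j)]
            rw [Finset.sum_mul]
            exact Finset.sum_congr rfl fun l _ => by ring
        _ = ∑ i, ∑ l, ∑ j, (((b l : N) : NormedAlgClosure F) : CompletedAlgClosure F) *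
              (pr l ((((b i : N) : NormedAlgClosure F) : CompletedAlgClosure F) *
                (((b j : N) : NormedAlgClosure F) : CompletedAlgClosure F)) * (u i * y j)) :=
            Finset.sum_congr rfl fun i _ => Finset.sum_comm
        _ = ∑ l, ∑ i, ∑ j, (((b l : N) : NormedAlgClosure F) : CompletedAlgClosure F) *
              (pr l ((((b i : N) : NormedAlgClosure F) : CompletedAlgClosure F) *
                (((b j : N) : NormedAlgClosure F) : CompletedAlgClosure F)) * (u i * y j)) :=
            Finset.sum_comm
        _ = ∑ l, (((b l : N) : NormedAlgClosure F) : CompletedAlgClosure F) *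
              ∑ q : Fin e × Fin e, pr l ((((b q.1 : N) : NormedAlgClosure F) : CompletedAlgClosure F) *
                (((b q.2 : N) : NormedAlgClosure F) : CompletedAlgClosure F)) * (u q.1 * y q.2) := by
            refine Finset.sum_congr rfl fun l _ => ?_
            rw [Finset.mul_sum, Fintype.sum_prod_type]
    -- the coordinates of `a x`
    have hdX : ∀ l, ∑ q : Fin e × Fin e, pr l ((((b q.1 : N) : NormedAlgClosure F) : CompletedAlgClosure F) *
        (((b q.2 : N) : NormedAlgClosure F) : CompletedAlgClosure F)) * (pr q.1 a * pr q.2 x) ∈ X hp :=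
      fun l => sum_mem_X hp _ _ fun q _ => mul_mem_X hp (hcX _ _ l) (mul_mem_X hp (hprX ha _) (hprX hx _))
    have hax : a * x = ∑ l, (((b l : N) : NormedAlgClosure F) : CompletedAlgClosure F) *
        ∑ q : Fin e × Fin e, pr l ((((b q.1 : N) : NormedAlgClosure F) : CompletedAlgClosure F) *
          (((b q.2 : N) : NormedAlgClosure F) : CompletedAlgClosure F)) * (pr q.1 a * pr q.2 x) := by
      rw [← key (fun i => pr i a) (fun j => pr j x), ← hrec a ha, ← hrec x hx]
    have hprax : ∀ l, pr l (a * x) = ∑ q : Fin e × Fin e,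
        pr l ((((b q.1 : N) : NormedAlgClosure F) : CompletedAlgClosure F) *
          (((b q.2 : N) : NormedAlgClosure F) : CompletedAlgClosure F)) * (pr q.1 a * pr q.2 x) := by
      intro l
      conv_lhs => rw [hax]
      exact huniq _ hdX l
    -- `R_n` of the coordinates, by `K_n`-linearity of `R_n`
    have hRd : ∀ l, Rt (pr l (a * x)) = ∑ q : Fin e × Fin e,
        pr l ((((b q.1 : N) : NormedAlgClosure F) : CompletedAlgClosure F) *
          (((b q.2 : N) : NormedAlgClosure F) : CompletedAlgClosure F)) * (pr q.1 a * Rt (pr q.2 x)) := by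
      intro l
      rw [hprax l, Rt_eq _ (hdX l), Rhat_sum hp hn2 _ _
        (fun q => mul_mem_X hp (hcX _ _ l) (mul_mem_X hp (hprX ha _) (hprX hx _)))]
      refine Finset.sum_congr rfl fun q _ => ?_
      have h1 : (⟨pr l ((((b q.1 : N) : NormedAlgClosure F) : CompletedAlgClosure F) *
          (((b q.2 : N) : NormedAlgClosure F) : CompletedAlgClosure F)) * (pr q.1 a * pr q.2 x),
          mul_mem_X hp (hcX _ _ l) (mul_mem_X hp (hprX ha _) (hprX hx _))⟩ : X hp) =
          ⟨pr l ((((b q.1 : N) : NormedAlgClosure F) : CompletedAlgClosure F) *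
            (((b q.2 : N) : NormedAlgClosure F) : CompletedAlgClosure F)) *
            (((⟨pr q.1 a * pr q.2 x, mul_mem_X hp (hprX ha _) (hprX hx _)⟩ : X hp)) : CompletedAlgClosure F),
            mul_mem_X hp (hcX _ _ l) (mul_mem_X hp (hprX ha _) (hprX hx _))⟩ := rfl
      have h2 : (⟨pr q.1 a * pr q.2 x, mul_mem_X hp (hprX ha _) (hprX hx _)⟩ : X hp) =
          ⟨pr q.1 a * (((⟨pr q.2 x, hprX hx _⟩ : X hp)) : CompletedAlgClosure F),
            mul_mem_X hp (hprX ha _) (hprX hx _)⟩ := rfl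
      rw [h1, Rhat_mul_of_gen_smul_eq hp hn2 (hcX _ _ l) (hγc _ _ l), h2,
        Rhat_mul_of_gen_smul_eq hp hn2 (hprX ha _) (hγpra _), Rt_eq _ (hprX hx _)]
    -- assemble
    calc R (a * x) = ∑ l, (((b l : N) : NormedAlgClosure F) : CompletedAlgClosure F) * Rt (pr l (a * x)) :=
          R_apply _
      _ = ∑ l, (((b l : N) : NormedAlgClosure F) : CompletedAlgClosure F) *
            ∑ q : Fin e × Fin e, pr l ((((b q.1 : N) : NormedAlgClosure F) : CompletedAlgClosure F) *
              (((b q.2 : N) : NormedAlgClosure F) : CompletedAlgClosure F)) * (pr q.1 a * Rt (pr q.2 x)) :=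
          Finset.sum_congr rfl fun l _ => by rw [hRd l]
      _ = (∑ i, (((b i : N) : NormedAlgClosure F) : CompletedAlgClosure F) * pr i a) *
            ∑ j, (((b j : N) : NormedAlgClosure F) : CompletedAlgClosure F) * Rt (pr j x) :=
          (key (fun i => pr i a) (fun j => Rt (pr j x))).symm
      _ = a * R x := by rw [← hrec a ha, ← R_apply]
  -- (R5) the bound (TS2)
  have hR5 : ∀ x, Fix x → ‖R x‖ ≤ ‖(p : PadicBase F p hp)‖⁻¹ ^ (k + 1) * ‖x‖ := by
    intro x hx
    rw [R_apply]
    refine IsUltrametricDist.norm_sum_le_of_forall_le_of_nonneg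
      (mul_nonneg (pow_nonneg hπi0 _) (norm_nonneg _)) fun i _ => ?_
    calc ‖(((b i : N) : NormedAlgClosure F) : CompletedAlgClosure F) * Rt (pr i x)‖
          = ‖(((b i : N) : NormedAlgClosure F) : CompletedAlgClosure F)‖ * ‖Rt (pr i x)‖ := norm_mul _ _
      _ ≤ ‖(((b i : N) : NormedAlgClosure F) : CompletedAlgClosure F)‖ *
            (‖(p : PadicBase F p hp)‖⁻¹ * (‖(((bd i : N) : NormedAlgClosure F) : CompletedAlgClosure F)‖ *
              ‖x‖)) := by
          refine mul_le_mul_of_nonneg_left ((Rt_norm _ (hprX hx i)).trans ?_) (norm_nonneg _)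
          exact mul_le_mul_of_nonneg_left (hbdd i x) hπi0
      _ = ‖(p : PadicBase F p hp)‖⁻¹ * (‖(((b i : N) : NormedAlgClosure F) : CompletedAlgClosure F)‖ *
            ‖(((bd i : N) : NormedAlgClosure F) : CompletedAlgClosure F)‖) * ‖x‖ := by ring
      _ ≤ ‖(p : PadicBase F p hp)‖⁻¹ * ‖(p : PadicBase F p hp)‖⁻¹ ^ k * ‖x‖ :=
          mul_le_mul_of_nonneg_right (mul_le_mul_of_nonneg_left (hbk i) hπi0) (norm_nonneg _)
      _ = ‖(p : PadicBase F p hp)‖⁻¹ ^ (k + 1) * ‖x‖ := by ring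
  -- (R6) the estimate (TS3)
  have hR6 : ∀ x, Fix x →
      ‖x - R x‖ ≤ ‖(p : PadicBase F p hp)‖⁻¹ ^ (k + 2) * ‖γ • x - x‖ := by
    intro x hx
    have h1 : x - R x = ∑ i, (((b i : N) : NormedAlgClosure F) : CompletedAlgClosure F) *
        (pr i x - Rt (pr i x)) := by
      have h0 : x - R x = (∑ i, (((b i : N) : NormedAlgClosure F) : CompletedAlgClosure F) * pr i x) -
          R x := by rw [← hrec x hx]
      rw [h0, R_apply, ← Finset.sum_sub_distrib]
      exact Finset.sum_congr rfl fun i _ => (mul_sub _ _ _).symm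
    have h2 : ∀ i, gen hp n • pr i x - pr i x = pr i (γ • x - x) := by
      intro i
      rw [map_sub, ← hequiv i γ hγN x hx, hγX _ (hprX hx i)]
    rw [h1]
    refine IsUltrametricDist.norm_sum_le_of_forall_le_of_nonneg
      (mul_nonneg (pow_nonneg hπi0 _) (norm_nonneg _)) fun i _ => ?_
    calc ‖(((b i : N) : NormedAlgClosure F) : CompletedAlgClosure F) * (pr i x - Rt (pr i x))‖
          = ‖(((b i : N) : NormedAlgClosure F) : CompletedAlgClosure F)‖ * ‖pr i x - Rt (pr i x)‖ :=
          norm_mul _ _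
      _ ≤ ‖(((b i : N) : NormedAlgClosure F) : CompletedAlgClosure F)‖ *
            (‖(p : PadicBase F p hp)‖⁻¹ ^ 2 * (‖(((bd i : N) : NormedAlgClosure F) : CompletedAlgClosure F)‖ *
              ‖γ • x - x‖)) := by
          refine mul_le_mul_of_nonneg_left ((Rt_TS3 _ (hprX hx i)).trans ?_) (norm_nonneg _)
          rw [h2 i]
          exact mul_le_mul_of_nonneg_left (hbdd i _) (pow_nonneg hπi0 2)
      _ = ‖(p : PadicBase F p hp)‖⁻¹ ^ 2 * (‖(((b i : N) : NormedAlgClosure F) : CompletedAlgClosure F)‖ *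
            ‖(((bd i : N) : NormedAlgClosure F) : CompletedAlgClosure F)‖) * ‖γ • x - x‖ := by ring
      _ ≤ ‖(p : PadicBase F p hp)‖⁻¹ ^ 2 * ‖(p : PadicBase F p hp)‖⁻¹ ^ k * ‖γ • x - x‖ :=
          mul_le_mul_of_nonneg_right (mul_le_mul_of_nonneg_left (hbk i) (pow_nonneg hπi0 2))
            (norm_nonneg _)
      _ = ‖(p : PadicBase F p hp)‖⁻¹ ^ (k + 2) * ‖γ • x - x‖ := by ring
  -- (R7) Tate's surjectivity `R v = 0 ⇒ v = γ c − c`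
  have hR7 : ∀ v, Fix v → R v = 0 → ∃ c, Fix c ∧ R c = 0 ∧ γ • c - c = v := by
    intro v hv hRv
    have hRt0 : ∀ i, Rhat hp n ⟨pr i v, hprX hv i⟩ = 0 := by
      intro i
      have h1 := pr_R hv i
      rw [hRv, map_zero] at h1
      rw [← Rt_eq _ (hprX hv i)]
      exact h1.symm
    choose c hcX hRc hγc using fun i => exists_gen_smul_sub_eq_of_Rhat_eq_zero hp hn2 (hprX hv i) (hRt0 i)
    refine ⟨∑ i, (((b i : N) : NormedAlgClosure F) : CompletedAlgClosure F) * c i, hspan c hcX, ?_, ?_⟩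
    · rw [R_apply]
      refine Finset.sum_eq_zero fun i _ => ?_
      rw [huniq c hcX i, Rt_eq _ (hcX i), hRc i, mul_zero]
    · rw [Finset.smul_sum, ← Finset.sum_sub_distrib]
      conv_rhs => rw [hrec v hv]
      refine Finset.sum_congr rfl fun i _ => ?_
      rw [smul_mul', hγ_coe (b i), ← mul_sub, hγX _ (hcX i), hγc i]
  -- (R8) `R = id` on the `γ`-invariants
  have hR8 : ∀ a, Fix a → γ • a = a → R a = a := by
    intro a ha hγa
    have h := hR6 a ha
    rw [hγa, sub_self, norm_zero, mul_zero] at h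
    exact (sub_eq_zero.mp (norm_le_zero_iff.mp h)).symm
  -- (R9) the `γ`-invariants of `X_N` lie in `N K_n`
  have hR9 : ∀ a, Fix a → γ • a = a →
      a ∈ ((↑) : NormedAlgClosure F → CompletedAlgClosure F) ''
        ((N ⊔ K hp n : IntermediateField (PadicBase F p hp) (NormedAlgClosure F)) :
          Set (NormedAlgClosure F)) := by
    intro a ha hγa
    have hγpr : ∀ i, gen hp n • pr i a = pr i a := fun i => by
      rw [← hγX _ (hprX ha i), hequiv i γ hγN a ha, hγa]
    choose w hwK hwpr using fun i => mem_image_K_of_gen_smul_eq hp hn2 (hprX ha i) (hγpr i)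
    refine ⟨∑ i, ((b i : N) : NormedAlgClosure F) * w i, ?_, ?_⟩
    · exact sum_mem fun i _ => mul_mem (le_sup_left (b := K hp n) (b i).2) (le_sup_right (a := N) (hwK i))
    · have hsum : (((∑ i, ((b i : N) : NormedAlgClosure F) * w i : NormedAlgClosure F)) :
          CompletedAlgClosure F) =
          ∑ i, (((b i : N) : NormedAlgClosure F) : CompletedAlgClosure F) * (w i : CompletedAlgClosure F) := by
        rw [show (((∑ i, ((b i : N) : NormedAlgClosure F) * w i : NormedAlgClosure F)) :
            CompletedAlgClosure F) =
            Completion.coeRingHom (∑ i, ((b i : N) : NormedAlgClosure F) * w i) from rfl, map_sum]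
        exact Finset.sum_congr rfl fun i _ => by rw [map_mul]; rfl
      rw [hsum, hrec a ha]
      exact Finset.sum_congr rfl fun i _ => by rw [hwpr i]
  -- (R10) `N K_n ⊆ X_N^{γ}`
  have hR10 : ∀ w ∈ N ⊔ K hp n, Fix ((w : NormedAlgClosure F) : CompletedAlgClosure F) ∧
      γ • ((w : NormedAlgClosure F) : CompletedAlgClosure F) = (w : CompletedAlgClosure F) := by
    intro w hw
    constructor
    · intro g hg hgN
      rw [CompletedAlgClosure.base_smul_coe, smul_eq_self_of_mem_sup hp N hgN
        ((TateSen.mem_baseKer_iff_forall_smul_zeta hp g).mp hg n) hw]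
    · rw [CompletedAlgClosure.base_smul_coe, smul_eq_self_of_mem_sup hp N hγN ?_ hw]
      rw [hγζ n]
      exact gen_smul_zeta_self hp hn1
  exact ⟨R, hγX, fun x hx => fix_smul hγN hx, hR1, hR2, hR3,
    fun x hx y hy => hR4 x y hx hy, hR4b, fun a ha x hx hγa => hR4c a x ha hx hγa, hR5, hR6,
    fun v hv hRv => (hR7 v hv hRv).imp fun c hc => ⟨hc.1, hc.2⟩, hR8, hR9, hR10⟩

end TateTrace

end Literature.NumberTheory.PAdicHodge
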